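import Summits.BirchSwinnertonDyer.Rank1Residual.Additive.X3BranchDegenerateEndStateLayerClassesT
import Summits.BirchSwinnertonDyer.Rank1Residual.Additive.X3BranchResidualQuotSelmerLayerTwoLowerBound
import HarnessLib

/-!
# X3, the DEGENERATE rows at `p = 3`, rank `0`, OFF the sub-locus, LAYER TWO: `BSD₃` from EXHIBITED classes
# with the U-side over the SECOND layer `ℚ_2 = ℚ(ζ₂₇)⁺` and the T-side over the first layer (cell
# `bsd-eis`, seat `bsd-eis-x3` gen 8; sequel of `X3BranchDegenerateEndStateLayerClassesT.lean` with
# `X3Branch.pow_card_le_natCard_residualQuotSelmer_of_trivialLine_layerTwo` in place of gen 7's layer-one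
# U-side bound; reaches the live rows whose U-side needs `s_ℓ = 9` but whose T-side stays at layer `≤ 1`
# (x3-MEMO-10 §5: 199386p3 322452v2 388278g2 402534h2); route K1 `AdditiveBranchIMC`, crux
# `GordTwoRankZeroOffCaseOne` — supports only)

HONEST FRAMING (FULL-BSD rank-`≤ 1` programme D-0033, cell `bsd-eis`): nothing is booked and no label
moves here; THEOREMS ONLY. Gen 6's end state `…_of_cardGe` with its lower bound DISCHARGED by the
T-side count of gen 8 (conductor-`ℓ` characters + layer-one twisted Kummer classes, `ζ₉` a primitive
`9`-th root of unity) and the layer-TWO U-side count (units `a_i = Σ_k P_{ik} θ₂^k`, `θ₂ = ζ + ζ²⁶`, `ζ` a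
primitive `27`-th root of unity, with cofactors, one cube certificate each, the multiplication table of
`θ₂`, and the `9×9` cubic-residue certificate), under `n + Σδ + 1 ≤ #T + #J + #ι`.
[cite: GreenbergVatsal2000, §2 pp. 26–30] [cite: GreenbergLNM1716, §3 p. 86] [cite: Delbourgo1998, Prop. 4]
[cite: Wuthrich2014, Thm. 16]
-/

set_option autoImplicit false

noncomputable section

open scoped Classical

namespace Summit.BirchSwinnertonDyer.Rank1Residual.Additive

open WeierstrassCurve NumberField IsDedekindDomain Field
  Literature.NumberTheory.EllipticCurves
  Literature.NumberTheory.EllipticCurves.ModularForms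
  Literature.NumberTheory.EllipticCurves.GreenbergSelmer
  Literature.NumberTheory.EllipticCurves.GreenbergVatsal2000
  Literature.NumberTheory.EllipticCurves.Rank1Residual
  Literature.NumberTheory.EllipticCurves.Rank1Residual.Typed
  Literature.NumberTheory.GaloisRepresentations
  Summit.BirchSwinnertonDyer.Rank1Residual.X1.MuLambda
  Summit.BirchSwinnertonDyer.Rank1Residual.AdditivePotMult
  Summit.BirchSwinnertonDyer.Rank1Residual.Additive.X3Branch

/-- **`BSD₃(W)` on the DEGENERATE X3♯(G-ord, `e = 2`) rows of rank `0` from EXHIBITED classes, U-side over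
the second layer `ℚ_2`, T-side over the first layer.** See the module docstring.
[cite: GreenbergVatsal2000, §2 pp. 26–30] [cite: GreenbergLNM1716, §3 p. 86]
[cite: Delbourgo1998, Prop. 4] [cite: Wuthrich2014, Thm. 16] -/
theorem ClassX3Gord.bsdp_three_rankZero_degenerate_of_facts_of_torsionFact_of_layerTwoClasses
    [Fact (Nat.Prime 3)] {W : WeierstrassCurve ℚ} [W.IsElliptic] [W.IsGloballyMinimal]
    (hTors : Greenberg1999.finite_torsion_cyclotomicZpExtension)
    (hDelG : Delbourgo1998.prop4_rankZero_constantCoeff_eq_unit_mul_of_potGoodOrd)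
    (hDel98 : Delbourgo1998.prop4_rankZero_pow_dvd_constantCoeff)
    (hGZK : rank_eq_analyticRank_of_analyticRank_le_one) (hmod : hasEntireLFunction_rat)
    (hmodD : nonempty_modularParametrizationData)
    (hW16 : Wuthrich2014.thm16_halfEigenCharIdeal_dvd_cyclotomicPrime)
    (h23 : datumSelmer_nonPrimitive_invariants)
    (hRQ : datumSelmer_divisible_of_finite_torsionBy_of_gr_inertiaInvariants_eq_zero)
    (hGrK : Greenberg1999.imKummer_ge_strictCondition_goodOrdinary)
    (hLiftE : residualEpsilon_surjOn_of_lineEven)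
    (hX : ClassX3Gord W 3) (hr : W.analyticRank = 0)
    (S₀ : Finset (HeightOneSpectrum (𝓞 ℚ))) (hne : S₀.Nonempty)
    (hS₀ : ∀ v ∈ S₀, (((3 : ℕ) : ℕ) : 𝓞 ℚ) ∉ v.asIdeal)
    (hS : ∀ v : HeightOneSpectrum (𝓞 ℚ), v ∉ S₀ → (((3 : ℕ) : ℕ) : 𝓞 ℚ) ∉ v.asIdeal →
      W.HasGoodReductionAt v)
    (Φ₀ : AddSubgroup (W.geomTorsion ((3 : ℕ) : ℤ))) (hΦ : IsRationalLine W 3 Φ₀)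
    (htriv : ∀ (σ : absoluteGaloisGroup ℚ) (Pt : geomTorsion W ((3 : ℕ) : ℤ)), Pt ∈ Φ₀ → σ • Pt = Pt)
    {n : ℕ}
    (hcert : ∀ (V : WeierstrassCurve ℚ) [V.IsElliptic] [V.IsGloballyMinimal] (C : VariableChange ℚ),
      C • V.quadraticTwist ((-1) ^ ((3 : ℕ) / 2) * (3 : ℕ) : ℚ) = W → X3BranchUnitCoeffCertAt V 3 n)
    -- T-side, conductor-`ℓ` characters (gen 6)
    (T : Finset ℕ) (hT : ∀ ℓ ∈ T, ℓ.Prime ∧ 3 ∣ ℓ - 1 ∧ ∃ v ∈ S₀, ((ℓ : ℕ) : 𝓞 ℚ) ∈ v.asIdeal)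
    {ζ₉ : AlgebraicClosure ℚ} (hζ₉ : IsPrimitiveRoot ζ₉ 9)
    -- U-side over `ℚ_2` (gen 8)
    {ζ : AlgebraicClosure ℚ} (hζ : IsPrimitiveRoot ζ 27)
    (μ : Fin 9 → Fin 9 → Fin 9 → ℤ)
    (hθtab : ∀ i j : Fin 9, (ζ + ζ ^ 26) ^ (i : ℕ) * (ζ + ζ ^ 26) ^ (j : ℕ) =
      ∑ k : Fin 9, (μ k i j : AlgebraicClosure ℚ) * (ζ + ζ ^ 26) ^ (k : ℕ))
    {ι : Type} [Fintype ι] [DecidableEq ι]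
    (P B D Tc : ι → Fin 9 → ℤ) (nm : ι → ℕ) (hn0 : ∀ i, nm i ≠ 0)
    (hab : ∀ i, (∑ k : Fin 9, (P i k : AlgebraicClosure ℚ) * (ζ + ζ ^ 26) ^ (k : ℕ)) *
      (∑ k : Fin 9, (B i k : AlgebraicClosure ℚ) * (ζ + ζ ^ 26) ^ (k : ℕ)) = (nm i : AlgebraicClosure ℚ))
    (hnS : ∀ i (v : HeightOneSpectrum (𝓞 ℚ)), ((nm i : ℕ) : 𝓞 ℚ) ∈ v.asIdeal → v ∈ S₀)
    (hcube : ∀ i, (∑ k : Fin 9, (P i k : AlgebraicClosure ℚ) * (ζ + ζ ^ 26) ^ (k : ℕ)) *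
      (∑ k : Fin 9, (D i k : AlgebraicClosure ℚ) * (ζ + ζ ^ 26) ^ (k : ℕ)) ^ 3 =
      1 + 9 * ∑ k : Fin 9, (Tc i k : AlgebraicClosure ℚ) * (ζ + ζ ^ 26) ^ (k : ℕ))
    {R : ℕ} (q : Fin R → ℕ) (hq : ∀ ρ, (q ρ).Prime) (hq1 : ∀ ρ, 3 ∣ q ρ - 1)
    (r : (ρ : Fin R) → Fin 9 → ZMod (q ρ))
    (hrr : ∀ ρ kk, r ρ kk ^ 9 - 9 * r ρ kk ^ 7 + 27 * r ρ kk ^ 5 - 30 * r ρ kk ^ 3 + 9 * r ρ kk + 1 = 0)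
    (w : (ρ : Fin R) → Fin 9 → Fin 9 → ZMod (q ρ))
    (hw : ∀ ρ (c c' : Fin 9), ∑ kk, w ρ c kk * r ρ kk ^ c'.val = if c = c' then 1 else 0)
    (ω : (ρ : Fin R) → ZMod (q ρ)) (hω : ∀ ρ, ω ρ ^ 3 = 1 ∧ ω ρ ≠ 1)
    (e : Fin R → ι → ℕ)
    (he : ∀ ρ i, (∑ k : Fin 9, (P i k : ZMod (q ρ)) * r ρ 0 ^ (k : ℕ)) ^ ((q ρ - 1) / 3) = ω ρ ^ e ρ i)
    (hnz : ∀ ρ i, (∑ k : Fin 9, (P i k : ZMod (q ρ)) * r ρ 0 ^ (k : ℕ)) ≠ 0)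
    (L : ι → Fin R → ℤ)
    (hL : ∀ i i', (∑ ρ, (L i ρ : ZMod 3) * (e ρ i' : ZMod 3)) = if i = i' then 1 else 0)
    -- T-side over `ℚ_1` (gens 7–8): the layer Kummer classes
    {J : Type} [Fintype J] [DecidableEq J]
    (b b' : J → Fin 6 → ℤ) (E : J → Fin 3 → ℤ) (nT : J → ℕ) (hnT0 : ∀ j, nT j ≠ 0)
    (hnT : ∀ j, (∑ k : Fin 6, (b j k : AlgebraicClosure ℚ) * ζ₉ ^ (k : ℕ)) *
      (∑ k : Fin 6, (b' j k : AlgebraicClosure ℚ) * ζ₉ ^ (k : ℕ)) = (nT j : AlgebraicClosure ℚ))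
    (hnTS : ∀ j (v : HeightOneSpectrum (𝓞 ℚ)), ((nT j : ℕ) : 𝓞 ℚ) ∈ v.asIdeal → v ∈ S₀)
    (hflipT : ∀ j, (∑ k : Fin 6, (b j k : AlgebraicClosure ℚ) * (ζ₉ ^ 8) ^ (k : ℕ)) *
      (∑ k : Fin 6, (b j k : AlgebraicClosure ℚ) * ζ₉ ^ (k : ℕ)) =
      ((E j 0 : AlgebraicClosure ℚ) + E j 1 * (ζ₉ + ζ₉ ^ 8) + E j 2 * (ζ₉ + ζ₉ ^ 8) ^ 2) ^ 3)
    (hTn : ∀ ℓ ∈ T, ∀ j, ¬ ℓ ∣ nT j)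
    {R' : ℕ} (q' : Fin R' → ℕ) (hq' : ∀ ρ, (q' ρ).Prime) (hq27 : ∀ ρ, 27 ∣ q' ρ - 1)
    (r' : (ρ : Fin R') → Fin 6 → ZMod (q' ρ)) (hr' : ∀ ρ k, r' ρ k ^ 6 + r' ρ k ^ 3 + 1 = 0)
    (w' : (ρ : Fin R') → Fin 6 → Fin 6 → ZMod (q' ρ))
    (hw' : ∀ ρ (a a' : Fin 6), ∑ k, w' ρ a k * r' ρ k ^ a'.val = if a = a' then 1 else 0)
    (ω' : (ρ : Fin R') → ZMod (q' ρ)) (hω' : ∀ ρ, ω' ρ ^ 3 = 1 ∧ ω' ρ ≠ 1)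
    (e' : Fin R' → J → ℕ)
    (he' : ∀ ρ j, (∑ k : Fin 6, (b j k : ZMod (q' ρ)) * r' ρ 0 ^ (k : ℕ)) ^ ((q' ρ - 1) / 3) =
      ω' ρ ^ e' ρ j)
    (hnz' : ∀ ρ j, (∑ k : Fin 6, (b j k : ZMod (q' ρ)) * r' ρ 0 ^ (k : ℕ)) ≠ 0)
    (L' : J → Fin R' → ℤ)
    (hL' : ∀ j j', (∑ ρ, (L' j ρ : ZMod 3) * (e' ρ j' : ZMod 3)) = if j = j' then 1 else 0)
    (hcount : n + ∑ v ∈ S₀, delta W 3 v + 1 ≤ T.card + Fintype.card J + Fintype.card ι) :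
    BSDp W 3 := by
  refine ClassX3Gord.bsdp_three_rankZero_degenerate_of_facts_of_torsionFact_of_cardGe hTors hDelG
    hDel98 hGZK hmod hmodD hW16 h23 hRQ hGrK hLiftE hX hr S₀ hne hS₀ hS Φ₀ hΦ htriv hcert
    fun κ hκ hH hU ↦ ?_
  haveI := hH
  haveI := hU
  calc 3 ^ (n + ∑ v ∈ S₀, delta W 3 v + 1) ≤ 3 ^ (T.card + Fintype.card J + Fintype.card ι) :=
        Nat.pow_le_pow_right (by norm_num) hcount
    _ = 3 ^ (T.card + Fintype.card J) * 3 ^ Fintype.card ι := pow_add _ _ _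
    _ ≤ Nat.card (residualLineH1 W 3 κ S₀ Φ₀ hΦ) * Nat.card (residualQuotSelmer W 3 κ S₀ Φ₀ hΦ) :=
        Nat.mul_le_mul
          (X3Branch.pow_card_le_natCard_residualLineH1_of_trivialLine_layerOne κ hκ S₀ hS₀ hΦ htriv T hT
            hζ₉ b b' E nT hnT0 hnT hnTS hflipT hTn q' hq' hq27 r' hr' w' hw' ω' hω' e' he' hnz' L' hL')
          (X3Branch.pow_card_le_natCard_residualQuotSelmer_of_trivialLine_layerTwo κ hκ S₀ hΦ htriv hζ μ
            hθtab P B D Tc nm hn0 hab hnS hcube q hq hq1 r hrr w hw ω hω e he hnz L hL)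

end Summit.BirchSwinnertonDyer.Rank1Residual.Additive

end
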